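import Literature.NumberTheory.LFunctions.KMVSecondMainTermFloor
import Literature.NumberTheory.LFunctions.KMVMollifierDiagonalMainTerm
import Literature.NumberTheory.LFunctions.KMVDiagonalSlack

/-!
# Route `PrimeLevelFamEdge`, crux K_B `BeyondDiagonalBeatsQuarter` (stmt-Parity-20055), line `birth`:
# the POSITIVITY half of the registered stub S2 is not open — `second + T₂ ≥ 4` at `X²` below length 2

The rev-3 skeleton of `Cruxes/BeyondDiagonalBeatsQuarter/Lines/birth.lean` (lead ls-Bfam-prover-1)
closes K_B from S1 (`T₁ Δ' X² 1 = 0` below length `2`; proved inside from Bettin's printed twisted first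
moment + the landed stub D, p520179/p521148) and ONE open stub S2
`stub_secondCorrectionBelowSlackSomewhere`: on some sub-window `(a, b) ⊆ [1, min Δ 2]`, `a < 3/2`,
`0 < second + T₂ ∧ second + T₂ < 2·lin²` at the profile `X²`, `Q = 1`. This file records, on the
Theorems side and modulo the two PRINTED facts the route already carries or is to carry as support
items (`kowalskiMichel2000_petersson` = item `PeterssonPrinted`; `bettin2017_theorem11_primeLevel` =
the planned item `FirstMomentPrinted`), that the FIRST conjunct holds on the WHOLE window
`(1, min Δ 2)` with room to spare: by the Cauchy–Schwarz floor of the second main term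
(`KMV2000.sq_firstMainTerm_le_secondMainTerm_of_lt_two`, Literature `KMVSecondMainTermFloor`:
`(lin + T₁)² ≤ second + T₂`, the value never exceeds the even share `½`) and `T₁ = 0`, `lin = 2`:
`4 ≤ secondMomentForm Δ' X² 1 + T₂ Δ' X² 1`, i.e. `T₂ Δ' X² 1 ≥ −4/Δ'`. Hence S2 REDUCES to its upper
conjunct alone (`secondCorrectionBelowSlackSomewhere_of_upper`), equivalently to the band statement
`T₂ Δ' X² 1 < 4(Δ' − 1)/Δ'` on some sub-window below `3/2` (`…_of_T₂_band`) — the exact heart of the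
value crux (second-moment off-diagonal main term beyond the diagonal at one prime level: OPEN IN
PRINT, registry famE-02). Helper for the crux item; no Theses statement is asserted; standard axioms.
«The programme SEARCHES and TYPES; no claim about Landau–Siegel zeros, Theorems 1–2 of
arXiv:2211.02515 or a repaired Margin232 until a kernel theorem says so.»
-/

namespace Summit.Parity.GeneralizedHardyLittlewood.Theorems.BeyondDiagonalBeatsQuarter

open Polynomial
open Literature.NumberTheory.LFunctions

/-- **The positivity conjunct of S2, with room to spare.** Under Bettin's twisted first moment
(`T₁ Δ' X² 1 = 0` below length `2`, `KMV2000.T₁_apply_one_eq_zero_of_bettin`) and the Petersson fact: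
for every window `(1, Δ]`, every MA-consistent `(T₁, T₂)` and every `1 < Δ' < min Δ 2`,
`4 ≤ secondMomentForm Δ' X² 1 + T₂ Δ' X² 1` (Cauchy–Schwarz floor `(lin + T₁)² ≤ second + T₂`,
`lin = 2`). [cite: Bettin2017, Thm. 1.1] [cite: KowalskiMichelVanderKam2000, §2 p. 6 and §6 p. 19] -/
theorem four_le_secondMainTerm_X_sq_of_bettin_of_petersson (hB : bettin2017_theorem11_primeLevel)
    (hPet : KowalskiMichel2000.kowalskiMichel2000_petersson) :
    ∀ Δ : ℝ, 1 < Δ → ∀ T₁ T₂ : ℝ → ℝ[X] → ℝ[X] → ℝ, KMV2000.MomentAsymptotics 1 Δ T₁ T₂ →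
      ∀ Δ' : ℝ, 1 < Δ' → Δ' < min Δ 2 →
        4 ≤ KMV2000.secondMomentForm Δ' (X ^ 2) 1 + T₂ Δ' (X ^ 2) 1 := by
  intro Δ _ T₁ T₂ hMA Δ' h1 h2
  have hT₁ : T₁ Δ' (X ^ 2) 1 = 0 :=
    KMV2000.T₁_apply_one_eq_zero_of_bettin hB KMV2000.admissible_X_sq hMA h1 h2
  have h := KMV2000.sq_firstMainTerm_le_secondMainTerm_of_lt_two hPet hMA KMV2000.admissible_X_sq
    (by linarith) (lt_of_lt_of_le h2 (min_le_right _ _)) h1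
    (lt_of_lt_of_le h2 (min_le_left _ _)).le
  rw [hT₁, add_zero, KMV2000.linForm_X_sq_one] at h
  norm_num at h
  exact h

/-- The positivity conjunct of S2 on the whole window `(1, min Δ 2)`:
`0 < secondMomentForm Δ' X² 1 + T₂ Δ' X² 1`, modulo the two printed facts.
[cite: Bettin2017, Thm. 1.1] [cite: KowalskiMichelVanderKam2000, §6 p. 19] -/
theorem secondMainTerm_X_sq_pos_of_bettin_of_petersson (hB : bettin2017_theorem11_primeLevel)
    (hPet : KowalskiMichel2000.kowalskiMichel2000_petersson) :
    ∀ Δ : ℝ, 1 < Δ → ∀ T₁ T₂ : ℝ → ℝ[X] → ℝ[X] → ℝ, KMV2000.MomentAsymptotics 1 Δ T₁ T₂ →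
      ∀ Δ' : ℝ, 1 < Δ' → Δ' < min Δ 2 →
        0 < KMV2000.secondMomentForm Δ' (X ^ 2) 1 + T₂ Δ' (X ^ 2) 1 :=
  fun Δ hΔ T₁ T₂ hMA Δ' h1 h2 ↦ lt_of_lt_of_le (by norm_num)
    (four_le_secondMainTerm_X_sq_of_bettin_of_petersson hB hPet Δ hΔ T₁ T₂ hMA Δ' h1 h2)

/-- The floor as a bound on the off-diagonal main term itself: `−4/Δ' ≤ T₂ Δ' X² 1` for
`1 < Δ' < min Δ 2` (`secondMomentForm Δ' X² 1 = 4 + 4/Δ'`, `KMV2000.secondMomentForm_X_sq_one`); the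
value crux needs `T₂ Δ' X² 1 < 4(Δ' − 1)/Δ'` somewhere below `3/2` (`KMV2000.diagSlack_X_sq_one`).
[cite: Bettin2017, Thm. 1.1] [cite: KowalskiMichelVanderKam2000, §6 p. 19] -/
theorem neg_four_div_le_T₂_X_sq_of_bettin_of_petersson (hB : bettin2017_theorem11_primeLevel)
    (hPet : KowalskiMichel2000.kowalskiMichel2000_petersson) :
    ∀ Δ : ℝ, 1 < Δ → ∀ T₁ T₂ : ℝ → ℝ[X] → ℝ[X] → ℝ, KMV2000.MomentAsymptotics 1 Δ T₁ T₂ →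
      ∀ Δ' : ℝ, 1 < Δ' → Δ' < min Δ 2 → -4 / Δ' ≤ T₂ Δ' (X ^ 2) 1 := by
  intro Δ hΔ T₁ T₂ hMA Δ' h1 h2
  have h := four_le_secondMainTerm_X_sq_of_bettin_of_petersson hB hPet Δ hΔ T₁ T₂ hMA Δ' h1 h2
  rw [KMV2000.secondMomentForm_X_sq_one] at h
  have hΔ' : 0 < Δ' := by linarith
  rw [neg_div, neg_le_iff_add_nonneg]
  linarith

/-- **The value ceiling on the window, every profile.** Under the Petersson fact alone: for every window
`(1, Δ]`, every MA-consistent `(T₁, T₂)`, every admissible `P` and every `1 < Δ' ≤ Δ` with `Δ' < 2`,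
the Cauchy–Schwarz value `(lin + T₁)²/(2(second + T₂))` is `≤ ½` — at one prime level a mollified
first/second moment pair detects at most the even half of the harmonic family, whatever the
off-diagonal main terms are (`KMV2000.value_le_half`). [cite: KowalskiMichelVanderKam2000, §2 p. 6]
[cite: IwaniecConversations2006, §7 p. 97] -/
theorem value_le_half_of_petersson (hPet : KowalskiMichel2000.kowalskiMichel2000_petersson) :
    ∀ Δ : ℝ, 1 < Δ → ∀ T₁ T₂ : ℝ → ℝ[X] → ℝ[X] → ℝ, KMV2000.MomentAsymptotics 1 Δ T₁ T₂ →
      ∀ P : ℝ[X], KMV2000.Admissible P → ∀ Δ' : ℝ, 1 < Δ' → Δ' ≤ Δ → Δ' < 2 →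
        (KMV2000.linForm Δ' P 1 + T₁ Δ' P 1) ^ 2 /
            (2 * (KMV2000.secondMomentForm Δ' P 1 + T₂ Δ' P 1)) ≤ 1 / 2 :=
  fun _ _ _ _ hMA _ hP _ h1 h2 h3 ↦ KMV2000.value_le_half hPet hMA hP (by linarith) h1 h2
    (KMV2000.goodPrimesUnbounded_of_lt_two (by linarith) h3)

/-- **S2 reduces to its upper conjunct.** Modulo the two printed facts, the registered stub
`stub_secondCorrectionBelowSlackSomewhere` of the K_B line (signature verbatim as the conclusion) follows
from the UPPER inequality alone on some sub-window `(a, b) ⊆ [1, min Δ 2]` with `a < 3/2`: the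
positivity conjunct holds on all of `(1, min Δ 2)` (`secondMainTerm_X_sq_pos_of_bettin_of_petersson`).
[cite: Bettin2017, Thm. 1.1] [cite: KowalskiMichelVanderKam2000, §6 p. 19] -/
theorem secondCorrectionBelowSlackSomewhere_of_upper (hB : bettin2017_theorem11_primeLevel)
    (hPet : KowalskiMichel2000.kowalskiMichel2000_petersson)
    (hU : ∀ Δ : ℝ, 1 < Δ → ∀ T₁ T₂ : ℝ → ℝ[X] → ℝ[X] → ℝ, KMV2000.MomentAsymptotics 1 Δ T₁ T₂ →
      ∃ a b : ℝ, 1 ≤ a ∧ a < b ∧ b ≤ min Δ 2 ∧ a < 3 / 2 ∧ ∀ Δ' : ℝ, a < Δ' → Δ' < b →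
        KMV2000.secondMomentForm Δ' (X ^ 2) 1 + T₂ Δ' (X ^ 2) 1 <
          2 * KMV2000.linForm Δ' (X ^ 2) 1 ^ 2) :
    ∀ Δ : ℝ, 1 < Δ → ∀ T₁ T₂ : ℝ → ℝ[X] → ℝ[X] → ℝ, KMV2000.MomentAsymptotics 1 Δ T₁ T₂ →
      ∃ a b : ℝ, 1 ≤ a ∧ a < b ∧ b ≤ min Δ 2 ∧ a < 3 / 2 ∧ ∀ Δ' : ℝ, a < Δ' → Δ' < b →
        0 < KMV2000.secondMomentForm Δ' (X ^ 2) 1 + T₂ Δ' (X ^ 2) 1 ∧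
          KMV2000.secondMomentForm Δ' (X ^ 2) 1 + T₂ Δ' (X ^ 2) 1 <
            2 * KMV2000.linForm Δ' (X ^ 2) 1 ^ 2 := by
  intro Δ hΔ T₁ T₂ hMA
  obtain ⟨a, b, ha, hab, hb, ha32, hval⟩ := hU Δ hΔ T₁ T₂ hMA
  exact ⟨a, b, ha, hab, hb, ha32, fun Δ' h1' h2' ↦
    ⟨secondMainTerm_X_sq_pos_of_bettin_of_petersson hB hPet Δ hΔ T₁ T₂ hMA Δ'
      (lt_of_le_of_lt ha h1') (lt_of_lt_of_le h2' hb), hval Δ' h1' h2'⟩⟩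

/-- **S2 in band form.** Modulo the two printed facts, the registered stub S2 follows from: on some
sub-window `(a, b) ⊆ [1, min Δ 2]` with `a < 3/2`, the second-moment off-diagonal main term of the
profile `X²` stays strictly below the diagonal slack, `T₂ Δ' X² 1 < 4(Δ' − 1)/Δ'`
(`second = 4 + 4/Δ'`, `2·lin² = 8`; `KMV2000.diagSlack_X_sq_one`). Together with the floor
`T₂ Δ' X² 1 ≥ −4/Δ'` this is the exact target band of the value crux at `X²`.
[cite: Bettin2017, Thm. 1.1] [cite: KowalskiMichelVanderKam2000, §6 p. 19 and (30)–(32)] -/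
theorem secondCorrectionBelowSlackSomewhere_of_T₂_band (hB : bettin2017_theorem11_primeLevel)
    (hPet : KowalskiMichel2000.kowalskiMichel2000_petersson)
    (hBand : ∀ Δ : ℝ, 1 < Δ → ∀ T₁ T₂ : ℝ → ℝ[X] → ℝ[X] → ℝ, KMV2000.MomentAsymptotics 1 Δ T₁ T₂ →
      ∃ a b : ℝ, 1 ≤ a ∧ a < b ∧ b ≤ min Δ 2 ∧ a < 3 / 2 ∧ ∀ Δ' : ℝ, a < Δ' → Δ' < b →
        T₂ Δ' (X ^ 2) 1 < 4 * (Δ' - 1) / Δ') :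
    ∀ Δ : ℝ, 1 < Δ → ∀ T₁ T₂ : ℝ → ℝ[X] → ℝ[X] → ℝ, KMV2000.MomentAsymptotics 1 Δ T₁ T₂ →
      ∃ a b : ℝ, 1 ≤ a ∧ a < b ∧ b ≤ min Δ 2 ∧ a < 3 / 2 ∧ ∀ Δ' : ℝ, a < Δ' → Δ' < b →
        0 < KMV2000.secondMomentForm Δ' (X ^ 2) 1 + T₂ Δ' (X ^ 2) 1 ∧
          KMV2000.secondMomentForm Δ' (X ^ 2) 1 + T₂ Δ' (X ^ 2) 1 <
            2 * KMV2000.linForm Δ' (X ^ 2) 1 ^ 2 := by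
  refine secondCorrectionBelowSlackSomewhere_of_upper hB hPet fun Δ hΔ T₁ T₂ hMA ↦ ?_
  obtain ⟨a, b, ha, hab, hb, ha32, hval⟩ := hBand Δ hΔ T₁ T₂ hMA
  refine ⟨a, b, ha, hab, hb, ha32, fun Δ' h1' h2' ↦ ?_⟩
  have hΔ' : 0 < Δ' := by linarith
  have h := hval Δ' h1' h2'
  rw [KMV2000.secondMomentForm_X_sq_one, KMV2000.linForm_X_sq_one]
  rw [lt_div_iff₀ hΔ'] at h
  have key : 4 / Δ' < 4 - T₂ Δ' (X ^ 2) 1 := by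
    rw [div_lt_iff₀ hΔ', sub_mul]
    linarith
  have e8 : (2 : ℝ) * 2 ^ 2 = 8 := by norm_num
  rw [e8]
  linarith

end Summit.Parity.GeneralizedHardyLittlewood.Theorems.BeyondDiagonalBeatsQuarter
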